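import Summits.QuantumFields.YangMills.Theorems.ColdStartUniversalityLatticeLangevinPlaquetteConcentration
import HarnessLib

/-!
# Route `ColdStartUniversality` (fixed-cut-off package, Bakry–Émery side): VOLUME-UNIFORM VARIANCE / SUSCEPTIBILITY BOUNDS under the
# SU(2) Wilson measure `μ_(β')` on `(ℤ/L)³` at `|β'| < 1/12` — `Var_(μ_β')(S_W) ≤ 32·#𝒫/(1 − 12|β'|)` (plaquette susceptibility `O(1)` per plaquette)

Helper file (seat `ym-line-csu-p1`, g27; `--supports stmt-QuantumFields-24809`).  The Poincaré twin of `…PlaquetteConcentration`: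
* ★★ `wilson_variance_le_of_carre_uniform` — for `|β'| < 1/12`, every `C³` function `f` of the real link coordinates with carré du champ
  `Γ(f) ≤ s` on `SU(2)^E`:  `Var_(μ_β')(f∘coords) ≤ s / (2(1 − 12|β'|))`, independently of `L` (uniform Poincaré
  `wilson_generatorPoincare_uniform`, g25, + the energy identity `−∫F·𝓛f = ½∫Γ(f)`);
* ★★★ `wilson_actionDensity_variance_uniform` — `Var_(μ_β')(S_W/#𝒫) ≤ 32/((1 − 12|β'|)·#𝒫)` for the action density
  `S_W/#𝒫 = (#𝒫)⁻¹Σ_p (2 − Re tr U_p)` (`Γ(S_W/#𝒫) ≤ 64/#𝒫`, `wilson_plaquette_carre_le`);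
* ★★ `wilson_action_variance_uniform` — equivalently `Var_(μ_β')(S_W) = Σ_(p,p̄) Cov(Re tr U_p, Re tr U_p̄) ≤ 32·#𝒫/(1 − 12|β'|)`:
  the plaquette susceptibility is bounded UNIFORMLY IN THE VOLUME at strong coupling — Shen–Zhu–Zhu's susceptibility corollary
  (`(1/|𝒫|)Σ_(p,p̄) Cov(ReTr Q_p, ReTr Q_p̄) ≤ 16N(d−1)/K_𝒮` for `SU(N)`), here for `SU(2)`, `d = 3` in the tree's normalisation.
[cite: ShenZhuZhu2022, §4 Corollary 4.4 and the susceptibility corollary for Σ_p̄ Cov(ReTr Q_p, ReTr Q_p̄) proved after Lemma 4.5]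
HONEST FRAMING: FIXED cut-off and fixed `|β'| < 1/12` ("uniform" = in the torus size `L`); the route's scaling `β'_K → ∞` leaves the window;
24809 ASIDE not restated; no crux, rung or summit statement is proved; the Yang–Mills mass gap is NOT proved.  THEOREMS ONLY, no definition, no sorry.
-/

set_option autoImplicit false

noncomputable section

namespace Summit.QuantumFields.YangMills.Theorems.ColdStartUniversality

open MeasureTheory ProbabilityTheory Finset Filter Set Metric
open scoped BigOperators NNReal ENNReal Topology
open Literature.Probability.Process Literature.MathematicalPhysics.QuantumFieldTheory
open Literature.MathematicalPhysics.QuantumLattice (fundamentalRep fundamentalLatticeRep continuous_fundamentalRep)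

variable {L : ℕ} [NeZero L]

/-! ## §1. Variance from a carré-du-champ bound under the uniform Poincaré inequality -/

/-- ★★ **Variance bound from `Γ(f) ≤ s`, volume-uniform.**  For `|β'| < 1/12`, `f ∈ C³` with carré du champ `Γ(f) ≤ s` on `SU(2)^E`
(`Γ(f)(V) = Σ_(ij) ∂_if ∂_jf (σσᵀ)_(ij)(V)`): `∫ (F − ∫F dμ_(β'))² dμ_(β') ≤ s / (2(1 − 12|β'|))`, `F = f∘coords`
(Poincaré `(1−12|β'|)Var(F) ≤ −∫(F−m)𝓛f` and `−∫(F−m)·𝓛f = ½∫Γ(f) ≤ s/2`). [cite: ShenZhuZhu2022, §4 Theorem 4.2, Corollary 4.4] -/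
theorem wilson_variance_le_of_carre_uniform (L : ℕ) [NeZero L] (β' : ℝ)
    (f : (Edge 3 L × Fin 2 × Fin 2 × Bool → ℝ) → ℝ) (hf : ContDiff ℝ 3 f) (s : ℝ) (hβ : |β'| < 1 / 12) :
    let coords : GaugeConfig 3 L (Matrix.specialUnitaryGroup (Fin 2) ℂ) → (Edge 3 L × Fin 2 × Fin 2 × Bool → ℝ) :=
      fun V q => (fun z : ℂ => if q.2.2.2 then z.im else z.re)
        ((fundamentalRep (Fin 2) (V q.1) : Matrix (Fin 2) (Fin 2) ℂ) q.2.1 q.2.2.1)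
    let A : GaugeConfig 3 L (Matrix.specialUnitaryGroup (Fin 2) ℂ) → (Edge 3 L × Fin 2 × Fin 2 × Bool) →
        (Edge 3 L × Fin 2 × Fin 2 × Bool) → ℝ := fun V i j =>
      ∑ n : Edge 3 L × NoiseIdx 2,
        (if n.1 = i.1 then (fun z : ℂ => if i.2.2.2 then z.im else z.re)
          ((latticeLangevinDynamics (fundamentalLatticeRep 2) β').noise
            (matrixConfig (fundamentalRep (Fin 2)) V) i.1 n.2 i.2.1 i.2.2.1) else 0) *
        (if n.1 = j.1 then (fun z : ℂ => if j.2.2.2 then z.im else z.re)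
          ((latticeLangevinDynamics (fundamentalLatticeRep 2) β').noise
            (matrixConfig (fundamentalRep (Fin 2)) V) j.1 n.2 j.2.1 j.2.2.1) else 0)
    (∀ V, (∑ i : Edge 3 L × Fin 2 × Fin 2 × Bool, ∑ j : Edge 3 L × Fin 2 × Fin 2 × Bool, fderiv ℝ f (coords V) (Pi.single i 1) * fderiv ℝ f (coords V) (Pi.single j 1) * A V i j) ≤ s) →
      ∫ V, (f (coords V) - ∫ V', f (coords V') ∂(wilsonMeasure (d := 3) (L := L) (fundamentalRep (Fin 2)) β')) ^ 2 ∂(wilsonMeasure (d := 3) (L := L) (fundamentalRep (Fin 2)) β') ≤ s / (2 * (1 - 12 * |β'|)) := by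
  intro coords A hΓ
  classical
  haveI := secondCountableTopology_su2
  haveI := borelSpace_config L
  set μ : Measure (GaugeConfig 3 L (Matrix.specialUnitaryGroup (Fin 2) ℂ)) := (wilsonMeasure (d := 3) (L := L) (fundamentalRep (Fin 2)) β') with hμ
  haveI : IsProbabilityMeasure μ :=
    isProbabilityMeasure_wilsonMeasure (d := 3) (L := L) (fundamentalRep (Fin 2)) (continuous_fundamentalRep (Fin 2)) β'
  have hρ : 0 < 1 - 12 * |β'| := by linarith
  have hco : Continuous coords := continuous_coords (L := L)
  let gen : ((Edge 3 L × Fin 2 × Fin 2 × Bool → ℝ) → ℝ) → GaugeConfig 3 L (Matrix.specialUnitaryGroup (Fin 2) ℂ) → ℝ :=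
      fun h V =>
      (∑ i : Edge 3 L × Fin 2 × Fin 2 × Bool, fderiv ℝ h (coords V) (Pi.single i 1) *
          (fun z : ℂ => if i.2.2.2 then z.im else z.re)
            ((latticeLangevinDynamics (fundamentalLatticeRep 2) β').drift
              (matrixConfig (fundamentalRep (Fin 2)) V) i.1 i.2.1 i.2.2.1) +
      1 / 2 * ∑ i : Edge 3 L × Fin 2 × Fin 2 × Bool, ∑ j : Edge 3 L × Fin 2 × Fin 2 × Bool,
        fderiv ℝ (fun z => fderiv ℝ h z (Pi.single i 1)) (coords V) (Pi.single j 1) *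
          ∑ n : Edge 3 L × NoiseIdx 2,
            (if n.1 = i.1 then (fun z : ℂ => if i.2.2.2 then z.im else z.re)
              ((latticeLangevinDynamics (fundamentalLatticeRep 2) β').noise
                (matrixConfig (fundamentalRep (Fin 2)) V) i.1 n.2 i.2.1 i.2.2.1) else 0) *
            (if n.1 = j.1 then (fun z : ℂ => if j.2.2.2 then z.im else z.re)
              ((latticeLangevinDynamics (fundamentalLatticeRep 2) β').noise
                (matrixConfig (fundamentalRep (Fin 2)) V) j.1 n.2 j.2.1 j.2.2.1) else 0))
  set m : ℝ := ∫ V', f (coords V') ∂μ with hm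
  -- the centred function and its derivatives
  set h : (Edge 3 L × Fin 2 × Fin 2 × Bool → ℝ) → ℝ := fun z => f z - m with hhdef
  have hh : ContDiff ℝ 3 h := hf.sub contDiff_const
  have hfd_h : fderiv ℝ h = fderiv ℝ f := by
    funext z
    exact fderiv_sub_const m
  have hhV : ∀ V : (GaugeConfig 3 L (Matrix.specialUnitaryGroup (Fin 2) ℂ)), h (coords V) = f (coords V) - m := fun V => rfl
  have hgenh : ∀ V : (GaugeConfig 3 L (Matrix.specialUnitaryGroup (Fin 2) ℂ)), gen h V = gen f V := fun V => by simp only [gen, hfd_h]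
  -- Poincaré
  have hP : (1 - 12 * |β'|) * ∫ V, (f (coords V) - m) ^ 2 ∂μ ≤ -∫ V, (f (coords V) - m) * gen f V ∂μ :=
    wilson_generatorPoincare_uniform L β' hβ f hf
  -- a compactly supported copy of `h`
  let χ : ContDiffBump (0 : (Edge 3 L × Fin 2 × Fin 2 × Bool → ℝ)) := ⟨2, 3, by norm_num, by norm_num⟩
  set g₁ : (Edge 3 L × Fin 2 × Fin 2 × Bool → ℝ) → ℝ := fun y => (χ : (Edge 3 L × Fin 2 × Fin 2 × Bool → ℝ) → ℝ) y * h y with hg₁def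
  have hg₁ : ContDiff ℝ 3 g₁ := χ.contDiff.mul hh
  have hg₁c : HasCompactSupport g₁ := χ.hasCompactSupport.mul_right
  have hball : ∀ V : (GaugeConfig 3 L (Matrix.specialUnitaryGroup (Fin 2) ℂ)), coords V ∈ ball (0 : (Edge 3 L × Fin 2 × Fin 2 × Bool → ℝ)) 2 := by
    intro V
    rw [mem_ball, dist_zero_right]
    exact (norm_coords_le_one V).trans_lt (by norm_num)
  have hg₁ev : ∀ V : (GaugeConfig 3 L (Matrix.specialUnitaryGroup (Fin 2) ℂ)), g₁ =ᶠ[𝓝 (coords V)] h := by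
    intro V
    filter_upwards [isOpen_ball.mem_nhds (hball V)] with z hz
    have h1 : (χ : (Edge 3 L × Fin 2 × Fin 2 × Bool → ℝ) → ℝ) z = 1 := χ.one_of_mem_closedBall (ball_subset_closedBall hz)
    simp only [hg₁def, h1, one_mul]
  have hg₁val : ∀ V : (GaugeConfig 3 L (Matrix.specialUnitaryGroup (Fin 2) ℂ)), g₁ (coords V) = h (coords V) := fun V => (hg₁ev V).self_of_nhds
  have hg₁gen : ∀ V : (GaugeConfig 3 L (Matrix.specialUnitaryGroup (Fin 2) ℂ)), gen g₁ V = gen h V := fun V => generator_congr_of_eventuallyEq L β' V (hg₁ev V)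
  have hg₁fd : ∀ V : (GaugeConfig 3 L (Matrix.specialUnitaryGroup (Fin 2) ℂ)), fderiv ℝ g₁ (coords V) = fderiv ℝ f (coords V) := fun V => by
    rw [(hg₁ev V).fderiv_eq, hfd_h]
  -- the energy identity for `g₁` and `Γ(g₁) = Γ(f)` on the configuration space
  have hEn : 2 * ∫ V, g₁ (coords V) * gen g₁ V ∂μ = -∫ V, (∑ i : Edge 3 L × Fin 2 × Fin 2 × Bool, ∑ j : Edge 3 L × Fin 2 × Fin 2 × Bool, fderiv ℝ g₁ (coords V) (Pi.single i 1) * fderiv ℝ g₁ (coords V) (Pi.single j 1) * A V i j) ∂μ :=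
    two_mul_integral_mul_generator_eq_neg_carre L β' hg₁ hg₁c
  have hcarre : ∀ V : (GaugeConfig 3 L (Matrix.specialUnitaryGroup (Fin 2) ℂ)), (∑ i : Edge 3 L × Fin 2 × Fin 2 × Bool, ∑ j : Edge 3 L × Fin 2 × Fin 2 × Bool, fderiv ℝ g₁ (coords V) (Pi.single i 1) * fderiv ℝ g₁ (coords V) (Pi.single j 1) * A V i j) = (∑ i : Edge 3 L × Fin 2 × Fin 2 × Bool, ∑ j : Edge 3 L × Fin 2 × Fin 2 × Bool, fderiv ℝ f (coords V) (Pi.single i 1) * fderiv ℝ f (coords V) (Pi.single j 1) * A V i j) := by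
    intro V
    simp only [hg₁fd V]
  -- continuity of `Γ(f)` (for integrability)
  have hreim : ∀ (c : Bool) {φ : (GaugeConfig 3 L (Matrix.specialUnitaryGroup (Fin 2) ℂ)) → ℂ}, Continuous φ → Continuous fun V => (fun z : ℂ => if c then z.im else z.re) (φ V) := by
    intro c φ hφ; cases c
    · exact Complex.continuous_re.comp hφ
    · exact Complex.continuous_im.comp hφ
  have hnoise : ∀ (i : Edge 3 L × Fin 2 × Fin 2 × Bool) (n : Edge 3 L × NoiseIdx 2), Continuous fun V : (GaugeConfig 3 L (Matrix.specialUnitaryGroup (Fin 2) ℂ)) =>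
      (if n.1 = i.1 then (fun z : ℂ => if i.2.2.2 then z.im else z.re)
        ((latticeLangevinDynamics (fundamentalLatticeRep 2) β').noise (matrixConfig (fundamentalRep (Fin 2)) V)
          i.1 n.2 i.2.1 i.2.2.1) else 0) := by
    intro i n
    by_cases h : n.1 = i.1
    · simp only [if_pos h]
      exact hreim _ ((continuous_apply i.2.2.1).comp ((continuous_apply i.2.1).comp
        (continuous_noise_matrixConfig β' i.1 n.2)))
    · simp only [if_neg h]; exact continuous_const
  have hA : ∀ i j, Continuous fun V : (GaugeConfig 3 L (Matrix.specialUnitaryGroup (Fin 2) ℂ)) => A V i j := fun i j =>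
    continuous_finsetSum _ fun n _ => (hnoise i n).mul (hnoise j n)
  have hdf : ∀ v : (Edge 3 L × Fin 2 × Fin 2 × Bool → ℝ), Continuous fun V : (GaugeConfig 3 L (Matrix.specialUnitaryGroup (Fin 2) ℂ)) => fderiv ℝ f (coords V) v := fun v =>
    ((hf.continuous_fderiv (by norm_num)).clm_apply continuous_const).comp hco
  have hΓc : Continuous fun V : (GaugeConfig 3 L (Matrix.specialUnitaryGroup (Fin 2) ℂ)) => (∑ i : Edge 3 L × Fin 2 × Fin 2 × Bool, ∑ j : Edge 3 L × Fin 2 × Fin 2 × Bool, fderiv ℝ f (coords V) (Pi.single i 1) * fderiv ℝ f (coords V) (Pi.single j 1) * A V i j) :=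
    continuous_finsetSum _ fun i _ => continuous_finsetSum _ fun j _ => ((hdf _).mul (hdf _)).mul (hA i j)
  -- `−∫ (F − m)·𝓛f = ½ ∫ Γ(f) ≤ s/2`
  have e1 : ∫ V, (f (coords V) - m) * gen f V ∂μ = ∫ V, g₁ (coords V) * gen g₁ V ∂μ :=
    integral_congr_ae (ae_of_all _ fun V => by beta_reduce; rw [hg₁val V, hg₁gen V, hgenh V, hhV V])
  have e2 : -∫ V, (f (coords V) - m) * gen f V ∂μ = 1 / 2 * ∫ V, (∑ i : Edge 3 L × Fin 2 × Fin 2 × Bool, ∑ j : Edge 3 L × Fin 2 × Fin 2 × Bool, fderiv ℝ f (coords V) (Pi.single i 1) * fderiv ℝ f (coords V) (Pi.single j 1) * A V i j) ∂μ := by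
    have e3 : ∫ V, (∑ i : Edge 3 L × Fin 2 × Fin 2 × Bool, ∑ j : Edge 3 L × Fin 2 × Fin 2 × Bool, fderiv ℝ g₁ (coords V) (Pi.single i 1) * fderiv ℝ g₁ (coords V) (Pi.single j 1) * A V i j) ∂μ = ∫ V, (∑ i : Edge 3 L × Fin 2 × Fin 2 × Bool, ∑ j : Edge 3 L × Fin 2 × Fin 2 × Bool, fderiv ℝ f (coords V) (Pi.single i 1) * fderiv ℝ f (coords V) (Pi.single j 1) * A V i j) ∂μ :=
      integral_congr_ae (ae_of_all _ fun V => by beta_reduce; exact hcarre V)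
    rw [e1]
    linarith [hEn, e3]
  have hI : ∫ V, (∑ i : Edge 3 L × Fin 2 × Fin 2 × Bool, ∑ j : Edge 3 L × Fin 2 × Fin 2 × Bool, fderiv ℝ f (coords V) (Pi.single i 1) * fderiv ℝ f (coords V) (Pi.single j 1) * A V i j) ∂μ ≤ s := by
    have hi1 : Integrable (fun V : (GaugeConfig 3 L (Matrix.specialUnitaryGroup (Fin 2) ℂ)) => (∑ i : Edge 3 L × Fin 2 × Fin 2 × Bool, ∑ j : Edge 3 L × Fin 2 × Fin 2 × Bool, fderiv ℝ f (coords V) (Pi.single i 1) * fderiv ℝ f (coords V) (Pi.single j 1) * A V i j)) μ := integrable_of_continuous_of_compactSpace hΓc _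
    have hi2 : Integrable (fun _ : (GaugeConfig 3 L (Matrix.specialUnitaryGroup (Fin 2) ℂ)) => s) μ := integrable_const s
    have hmono := integral_mono hi1 hi2 fun V => hΓ V
    have hc : ∫ _ : (GaugeConfig 3 L (Matrix.specialUnitaryGroup (Fin 2) ℂ)), s ∂μ = s := by
      rw [integral_const]; simp
    rw [hc] at hmono
    exact hmono
  have hkey : (1 - 12 * |β'|) * ∫ V, (f (coords V) - m) ^ 2 ∂μ ≤ s / 2 := by
    rw [e2] at hP
    linarith
  rw [le_div_iff₀ (by positivity)]
  linarith

/-! ## §2. The action density: variance `O(1/#𝒫)`, susceptibility `O(1)` per plaquette -/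

/-- ★★★ **Volume-uniform variance bound for the action density at strong coupling.**  For every `L ≥ 1` and every `|β'| < 1/12`:
`∫ (S_W/#𝒫 − ∫ S_W/#𝒫 dμ_(β'))² dμ_(β') ≤ 32 / ((1 − 12|β'|)·#𝒫)` — the action density of an `SU(2)` lattice gauge field on `(ℤ/L)³`
has CLT-size fluctuations with an `L`-independent constant. [cite: ShenZhuZhu2022, §4 Corollary 4.4 and the susceptibility corollary after Lemma 4.5] -/
theorem wilson_actionDensity_variance_uniform (L : ℕ) [NeZero L] (β' : ℝ) (hβ : |β'| < 1 / 12) :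
    ∫ V, (wilsonAction (fundamentalRep (Fin 2)) V / (Fintype.card (Plaquette 3 L) : ℝ) - ∫ V', wilsonAction (fundamentalRep (Fin 2)) V' / (Fintype.card (Plaquette 3 L) : ℝ) ∂(wilsonMeasure (d := 3) (L := L) (fundamentalRep (Fin 2)) β')) ^ 2 ∂(wilsonMeasure (d := 3) (L := L) (fundamentalRep (Fin 2)) β')
      ≤ 32 / ((1 - 12 * |β'|) * (Fintype.card (Plaquette 3 L) : ℝ)) := by
  classical
  haveI := secondCountableTopology_su2
  haveI := borelSpace_config L
  set μ : Measure (GaugeConfig 3 L (Matrix.specialUnitaryGroup (Fin 2) ℂ)) := (wilsonMeasure (d := 3) (L := L) (fundamentalRep (Fin 2)) β') with hμ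
  haveI : IsProbabilityMeasure μ :=
    isProbabilityMeasure_wilsonMeasure (d := 3) (L := L) (fundamentalRep (Fin 2)) (continuous_fundamentalRep (Fin 2)) β'
  have hρ : 0 < 1 - 12 * |β'| := by linarith
  set nP : ℝ := (Fintype.card (Plaquette 3 L) : ℝ) with hnP
  have hnPpos : 0 < nP := card_plaquette_three_pos L
  set b : ℝ := nP⁻¹ with hb
  set co : (GaugeConfig 3 L (Matrix.specialUnitaryGroup (Fin 2) ℂ)) → (Edge 3 L × Fin 2 × Fin 2 × Bool → ℝ) := (fun (V : GaugeConfig 3 L (Matrix.specialUnitaryGroup (Fin 2) ℂ)) (q : Edge 3 L × Fin 2 × Fin 2 × Bool) => (fun z : ℂ => if q.2.2.2 then z.im else z.re) ((fundamentalRep (Fin 2) (V q.1) : Matrix (Fin 2) (Fin 2) ℂ) q.2.1 q.2.2.1)) with hco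
  set fp : (Edge 3 L × Fin 2 × Fin 2 × Bool → ℝ) → ℝ := (fun y : (Edge 3 L × Fin 2 × Fin 2 × Bool → ℝ) => b * ∑ p : Plaquette 3 L, (rootedLoop (fun (ee : Edge 3 L) (i j : Fin 2) => ((y (ee, i, j, false) : ℝ) : ℂ) + ((y (ee, i, j, true) : ℝ) : ℂ) * Complex.I) (p.1, p.2.1.1) p.2.1.2 false).trace.re) with hfp
  have hfpC : ContDiff ℝ 3 fp := contDiff_psiHat (d := 3) (L := L) (N := 2) (n := 3) b
  have hval : ∀ V, fp (co V) = 2 - wilsonAction (fundamentalRep (Fin 2)) V / nP := by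
    intro V
    have h : fp (co V) = 2 * b * nP - b * wilsonAction (fundamentalRep (Fin 2)) V := psiHat_coords_eq_wilsonAction b V
    rw [h, div_eq_mul_inv, hb]
    have : 2 * nP⁻¹ * nP = 2 := by rw [mul_assoc, inv_mul_cancel₀ hnPpos.ne', mul_one]
    rw [this]; ring
  have hcont : Continuous fun V => fp (co V) := hfpC.continuous.comp (continuous_coords (L := L))
  have hint : Integrable (fun V => wilsonAction (fundamentalRep (Fin 2)) V / nP) μ := by
    have hfun : (fun V => wilsonAction (fundamentalRep (Fin 2)) V / nP) = fun V => 2 - fp (co V) := funext fun V => by rw [hval]; ring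
    rw [hfun]
    exact integrable_of_continuous_of_compactSpace (continuous_const.sub hcont) _
  have hmean : ∫ V', fp (co V') ∂μ = 2 - ∫ V', wilsonAction (fundamentalRep (Fin 2)) V' / nP ∂μ := by
    have hfun : (fun V' => fp (co V')) = fun V' => (2 : ℝ) - wilsonAction (fundamentalRep (Fin 2)) V' / nP := funext hval
    rw [hfun, integral_sub (integrable_const _) hint, integral_const]
    simp
  have hvar : ∫ V, (fp (co V) - ∫ V', fp (co V') ∂μ) ^ 2 ∂μ ≤ (64 * b ^ 2 * nP) / (2 * (1 - 12 * |β'|)) :=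
    wilson_variance_le_of_carre_uniform L β' fp hfpC (64 * b ^ 2 * nP) hβ (wilson_plaquette_carre_le L β' b)
  have hsq : ∀ V, (fp (co V) - ∫ V', fp (co V') ∂μ) ^ 2 = (wilsonAction (fundamentalRep (Fin 2)) V / nP - ∫ V', wilsonAction (fundamentalRep (Fin 2)) V' / nP ∂μ) ^ 2 := by
    intro V
    rw [hmean, hval]
    ring
  have hI : ∫ V, (wilsonAction (fundamentalRep (Fin 2)) V / nP - ∫ V', wilsonAction (fundamentalRep (Fin 2)) V' / nP ∂μ) ^ 2 ∂μ = ∫ V, (fp (co V) - ∫ V', fp (co V') ∂μ) ^ 2 ∂μ :=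
    integral_congr_ae (ae_of_all _ fun V => by beta_reduce; rw [hsq V])
  have hconst : (64 * b ^ 2 * nP) / (2 * (1 - 12 * |β'|)) = 32 / ((1 - 12 * |β'|) * nP) := by
    rw [hb]
    field_simp
    ring
  rw [hI, ← hconst]
  exact hvar

/-- ★★ **Volume-uniform plaquette susceptibility bound.**  For every `L ≥ 1` and `|β'| < 1/12`:
`Var_(μ_β')(S_W) = ∫ (S_W − ∫S_W dμ_(β'))² dμ_(β') ≤ 32·#𝒫/(1 − 12|β'|)`, i.e. `(1/#𝒫) Σ_(p,p̄) Cov_(μ_β')(Re tr U_p, Re tr U_p̄) ≤ 32/(1−12|β'|)`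
— Shen–Zhu–Zhu's `16N(d−1)/K_𝒮` for `SU(N)` at `N = 2`, `d = 3`, in the tree's normalisation (`Ric = 1`, rate `1 − 12|β'|`).
[cite: ShenZhuZhu2022, §4 susceptibility corollary after Lemma 4.5] -/
theorem wilson_action_variance_uniform (L : ℕ) [NeZero L] (β' : ℝ) (hβ : |β'| < 1 / 12) :
    ∫ V, (wilsonAction (fundamentalRep (Fin 2)) V - ∫ V', wilsonAction (fundamentalRep (Fin 2)) V' ∂(wilsonMeasure (d := 3) (L := L) (fundamentalRep (Fin 2)) β')) ^ 2 ∂(wilsonMeasure (d := 3) (L := L) (fundamentalRep (Fin 2)) β')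
      ≤ 32 * (Fintype.card (Plaquette 3 L) : ℝ) / (1 - 12 * |β'|) := by
  classical
  haveI := secondCountableTopology_su2
  haveI := borelSpace_config L
  set μ : Measure (GaugeConfig 3 L (Matrix.specialUnitaryGroup (Fin 2) ℂ)) := (wilsonMeasure (d := 3) (L := L) (fundamentalRep (Fin 2)) β') with hμ
  haveI : IsProbabilityMeasure μ :=
    isProbabilityMeasure_wilsonMeasure (d := 3) (L := L) (fundamentalRep (Fin 2)) (continuous_fundamentalRep (Fin 2)) β'
  have hρ : 0 < 1 - 12 * |β'| := by linarith
  set nP : ℝ := (Fintype.card (Plaquette 3 L) : ℝ) with hnP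
  have hnPpos : 0 < nP := card_plaquette_three_pos L
  have h := wilson_actionDensity_variance_uniform L β' hβ
  -- `S_W/nP − ∫S_W/nP = (S_W − ∫S_W)/nP`
  have hdiv : ∫ V', wilsonAction (fundamentalRep (Fin 2)) V' / nP ∂μ = (∫ V', wilsonAction (fundamentalRep (Fin 2)) V' ∂μ) / nP := integral_div nP _
  have hsq : ∀ V : (GaugeConfig 3 L (Matrix.specialUnitaryGroup (Fin 2) ℂ)), (wilsonAction (fundamentalRep (Fin 2)) V / nP - ∫ V', wilsonAction (fundamentalRep (Fin 2)) V' / nP ∂μ) ^ 2 = (wilsonAction (fundamentalRep (Fin 2)) V - ∫ V', wilsonAction (fundamentalRep (Fin 2)) V' ∂μ) ^ 2 / nP ^ 2 := by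
    intro V
    rw [hdiv]
    field_simp
  have hI : ∫ V, (wilsonAction (fundamentalRep (Fin 2)) V / nP - ∫ V', wilsonAction (fundamentalRep (Fin 2)) V' / nP ∂μ) ^ 2 ∂μ = (∫ V, (wilsonAction (fundamentalRep (Fin 2)) V - ∫ V', wilsonAction (fundamentalRep (Fin 2)) V' ∂μ) ^ 2 ∂μ) / nP ^ 2 := by
    rw [← integral_div]
    exact integral_congr_ae (ae_of_all _ fun V => by beta_reduce; rw [hsq V])
  have h' : (∫ V, (wilsonAction (fundamentalRep (Fin 2)) V - ∫ V', wilsonAction (fundamentalRep (Fin 2)) V' ∂μ) ^ 2 ∂μ) / nP ^ 2 ≤ 32 / ((1 - 12 * |β'|) * nP) := by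
    rw [← hI]; exact h
  rw [div_le_iff₀ (by positivity)] at h'
  calc ∫ V, (wilsonAction (fundamentalRep (Fin 2)) V - ∫ V', wilsonAction (fundamentalRep (Fin 2)) V' ∂μ) ^ 2 ∂μ ≤ 32 / ((1 - 12 * |β'|) * nP) * nP ^ 2 := h'
    _ = 32 * nP / (1 - 12 * |β'|) := by
        field_simp

end Summit.QuantumFields.YangMills.Theorems.ColdStartUniversality
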